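import Literature.MathematicalPhysics.QuantumFieldTheory.Balaban1983to89.B15BasicStep
import Literature.MathematicalPhysics.QuantumFieldTheory.Balaban1983to89.B15Ineq194Flow

/-!
# `Balaban1983to89.B15Ineq194Last` — [Balaban1989LargeFieldI] p. 198, (1.94): the LAST printed inequality *"< αε_h"*
# PROVED from the two printed restrictions on `N` (the typed `B15.BasicStep.RestrN194` and *"the constant in the second
# term … bounded by (1/2)α"*) plus the `γ`-smallness they presuppose; with b01∕r2's sign-free first inequality
# (`B15.Ineq194Flow.ineq194_first_le_signfree`) the whole displayed chain after the ℍ-input holds along any [III] flow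

statement-level skeleton of published theorems with citation tags; proofs where landed; nothing here is a claim about
the Yang–Mills mass gap.

CITATION HEADER (lean-in-tree rule 2026-08-18).  T. Bałaban, *Large field renormalization. I. The basic step of the 𝐑
operation*, Commun. Math. Phys. **122**, 175–202 (1989), doi:10.1007/BF01257412, bib `Balaban1989LargeFieldI` (cell
paper B15; PDF held `paper:balaban1989-cmp122-large-field-i`, journal page = PDF page + 174; p. 198 READ AS AN IMAGE on
the x2 render `run/shared/lean/pub/pub-balaban/b2b-balaban-ref1/pages/1989-cmp122-large-field-I/…-p024-x2.png`).
WHAT IS REPRODUCED: SKELETON row `B15.Eq1.94` (its last member), unit `lit-balaban-r12` gen 8 (reader/typer and fold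
owner of block B15, Phase 2 in own block), HOME `run/shared/lean/pub/lit-balaban/` (`lit-balaban-r12/ROWS-B15.md`).  Used
BY NAME: `B15.BasicStep.RestrN194` (the first restriction as typed) and `restrN194_exponent` (why `ν/2 ≦ p₀ − p₁ − 1` is
the right exponent condition), `B15.Ineq194Flow.ineq194_first_le_signfree` (the first inequality of (1.94) along a flow,
`deltaPrimeK`, `logPow`), `B14FlowStep` (`Flow`, `SmallnessFor`, `log_inv_sq_mono`).

THE PRINTED TEXT (p. 198 [PDF 24], verbatim; v1.1: «ℍ_{h,□} … on □^∼» restored — v1 had «ℍ∕□ … on the same domains as above»,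
the latter being the p. 199 B₃δ′_k sentence —, `lit-balaban-r12/QUOTE-AUDIT-B15.md` L5; docstring only): *"The function ℍ_{h,□} above,
and its derivatives, can be bounded on □^∼ by B₃δ′_k + L^{−(k−h)}O(1)B₃³B₅M⁶ε_k ≦ B₃(1 + β₀)N^{1/2}(A₁/A₀)(p₁(g_h)/p₀(g_h))ε_h + L^{−N}N^{1/2}O(1)B₃³B₅M⁶ε_h < αε_h.
(1.94)  The last inequality holds under two restrictions on N. At first, we assume that N ≦ O(1)(log g_k⁻²)^ν ≦
O(1)(1 + β₀)(log g_h⁻²)^ν with a positive integer ν satisfying (1/2)ν ≦ p₀ − p₁ − 1. The second is that N has to be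
sufficiently large, so that the constant in the second term above can be bounded by (1/2)α. These two conditions can be
satisfied by N to the positive power of log g_k⁻²."*  (`N = k − h`, p. 177; `p₁(g) = (log g⁻²)^{p₁}`, `p₀(g) = (log g⁻²)^{p₀}`,
p. 183.)

WHAT IS PROVED (0 `sorry`, no `def`, no new `Prop`).  With `x = log g_h⁻² ≧ 1`:
* `sqrtN_le` — the first restriction `N ≦ C·x^ν` (`RestrN194 N C x ν p₀ p₁`) gives `N^{1/2} ≦ C^{1/2}x^{ν/2}`;
* `term1_le` — hence the first term is `≦ B₃(1+β₀)(A₁/A₀)C^{1/2}·x^{ν/2}x^{p₁}/x^{p₀}·ε_h ≦ B₃(1+β₀)(A₁/A₀)C^{1/2}·x^{−1}·ε_h`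
  (`restrN194_exponent`: this is where `(1/2)ν ≦ p₀ − p₁ − 1` enters);
* `ineq194_last` — **the last inequality of (1.94)**: first term `< ½αε_h` as soon as `B₃(1+β₀)(A₁/A₀)C^{1/2}x^{−1} < ½α`
  (the `γ`-smallness the text presupposes: `x ≧ log γ⁻²`, `term1_coeff_le_of_gamma`), second term `≦ ½αε_h` by the second
  restriction AS PRINTED (`L^{−N}N^{1/2}O(1)B₃³B₅M⁶ ≦ ½α`, hypothesis), so the sum is `< αε_h` (`ε_h > 0`);
* `ineq194_chain_along_flow` — composed with `B15.Ineq194Flow.ineq194_first_le_signfree`: along any flow of the [III]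
  setting, `B₃δ′_k + L^{−(k−h)}·O(1)B₃³B₅M⁶·ε_k < αε_h` for `h < k ≦ K` under the two restrictions on `N = k − h` and the
  `γ`-clause (the second term's `O(1)` read as `O(1)(1+β₀)` exactly as in that module).
HONEST SCOPE.  The first member of (1.94) (the bound of ℍ by `B₃δ′_k + …`, from [12]/[14]) is the leaf's input and is not
touched.  The `γ`-clause is what the first restriction needs to be effective (the text's *"can be satisfied by N to the
positive power of log g_k⁻²"* presupposes `log g⁻²` large); it is an explicit hypothesis, not derived.  Real bookkeeping
only; value = the row's printed restrictions shown sufficient, kernel-checked; NOT summit progress.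
-/

namespace Literature.MathematicalPhysics.QuantumFieldTheory.Balaban1983to89.B15Ineq194Last

open Literature.MathematicalPhysics.QuantumFieldTheory.Balaban1983to89
open B15.BasicStep B15.Ineq194Flow B14FlowStep

/-! ## §1. The first restriction on `N` and the first term -/

/-- From the first restriction `N ≦ C·x^ν` (`B15.BasicStep.RestrN194`), `N, C, x ≧ 0`: `N^{1/2} ≦ C^{1/2}·x^{ν/2}`.
[cite: Balaban1989LargeFieldI, (1.94) p.198] -/
theorem sqrtN_le {N C x ν p₀ p₁ : ℝ} (hR : RestrN194 N C x ν p₀ p₁) (hC : 0 ≤ C) (hx : 0 ≤ x) :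
    Real.sqrt N ≤ Real.sqrt C * x ^ (ν / 2) := by
  obtain ⟨hN, -⟩ := hR
  have h1 : Real.sqrt N ≤ Real.sqrt (C * x ^ ν) := Real.sqrt_le_sqrt hN
  have h2 : Real.sqrt (C * x ^ ν) = Real.sqrt C * Real.sqrt (x ^ ν) := Real.sqrt_mul hC _
  have h3 : Real.sqrt (x ^ ν) = x ^ (ν / 2) := by
    rw [Real.sqrt_eq_rpow, ← Real.rpow_mul hx]
    ring_nf
  rw [h2, h3] at h1
  exact h1

/-- **The first term of (1.94) under the first restriction**, p. 198: with `x = log g_h⁻² ≧ 1`,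
`p₁(g_h)/p₀(g_h) = x^{p₁}/x^{p₀}`, `N ≦ C·x^ν` and `(1/2)ν ≦ p₀ − p₁ − 1` (`RestrN194 N C x ν p₀ p₁`), signs
`B₃(1+β₀)(A₁/A₀) ≧ 0`, `C ≧ 0`, `ε_h ≧ 0`:
`B₃(1+β₀)N^{1/2}(A₁/A₀)(x^{p₁}/x^{p₀})ε_h ≦ B₃(1+β₀)(A₁/A₀)C^{1/2}·x^{−1}·ε_h` (`B15.BasicStep.restrN194_exponent`).
[cite: Balaban1989LargeFieldI, (1.94) p.198] -/
theorem term1_le {B₃ β₀ A₀ A₁ x N ν C εh : ℝ} {p₀ p₁ : ℕ} (hR : RestrN194 N C x ν (p₀ : ℝ) (p₁ : ℝ))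
    (hx : 1 ≤ x) (hC : 0 ≤ C) (hB : 0 ≤ B₃ * (1 + β₀) * (A₁ / A₀)) (hεh : 0 ≤ εh) :
    B₃ * ((1 + β₀) * Real.sqrt N * ((A₁ / A₀) * (x ^ p₁ / x ^ p₀) * εh))
      ≤ B₃ * (1 + β₀) * (A₁ / A₀) * Real.sqrt C * x ^ (-1 : ℝ) * εh := by
  have hx0 : 0 ≤ x := by linarith
  have hsq := sqrtN_le hR hC hx0
  have hexp := restrN194_exponent (p₀ := (p₀ : ℝ)) (p₁ := (p₁ : ℝ)) hx hR.2
  rw [Real.rpow_natCast, Real.rpow_natCast] at hexp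
  have hratio : 0 ≤ x ^ p₁ / x ^ p₀ := by positivity
  -- N^{1/2}·(x^{p₁}/x^{p₀}) ≤ C^{1/2}·x^{−1}
  have hkey : Real.sqrt N * (x ^ p₁ / x ^ p₀) ≤ Real.sqrt C * x ^ (-1 : ℝ) := by
    calc Real.sqrt N * (x ^ p₁ / x ^ p₀) ≤ Real.sqrt C * x ^ (ν / 2) * (x ^ p₁ / x ^ p₀) :=
          mul_le_mul_of_nonneg_right hsq hratio
      _ = Real.sqrt C * (x ^ (ν / 2) * x ^ p₁ / x ^ p₀) := by ring
      _ ≤ Real.sqrt C * x ^ (-1 : ℝ) := mul_le_mul_of_nonneg_left hexp (Real.sqrt_nonneg C)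
  have := mul_le_mul_of_nonneg_left hkey (mul_nonneg hB hεh)
  calc B₃ * ((1 + β₀) * Real.sqrt N * ((A₁ / A₀) * (x ^ p₁ / x ^ p₀) * εh))
      = B₃ * (1 + β₀) * (A₁ / A₀) * εh * (Real.sqrt N * (x ^ p₁ / x ^ p₀)) := by ring
    _ ≤ B₃ * (1 + β₀) * (A₁ / A₀) * εh * (Real.sqrt C * x ^ (-1 : ℝ)) := this
    _ = B₃ * (1 + β₀) * (A₁ / A₀) * Real.sqrt C * x ^ (-1 : ℝ) * εh := by ring

/-- Why the first restriction is effective for small `γ` (*"These two conditions can be satisfied by N to the positive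
power of log g_k⁻²"*): `x = log g_h⁻² ≧ log γ⁻²` for `0 < g_h ≦ γ`, so the coefficient `K·x^{−1}` of `term1_le` is
`≦ K·(log γ⁻²)^{−1}` (`K ≧ 0`, `log γ⁻² > 0`). [cite: Balaban1989LargeFieldI, (1.94) p.198] -/
theorem term1_coeff_le_of_gamma {K g γ : ℝ} (hK : 0 ≤ K) (hg : 0 < g) (hgγ : g ≤ γ)
    (hγ : 0 < Real.log (γ ^ 2)⁻¹) :
    K * (Real.log (g ^ 2)⁻¹) ^ (-1 : ℝ) ≤ K * (Real.log (γ ^ 2)⁻¹) ^ (-1 : ℝ) := by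
  apply mul_le_mul_of_nonneg_left _ hK
  exact Real.rpow_le_rpow_of_nonpos hγ (log_inv_sq_mono hg hgγ) (by norm_num)

/-! ## §2. The last inequality of (1.94) -/

/-- **(1.94), last member** p. 198, verbatim: *"… ≦ B₃(1 + β₀)N^{1/2}(A₁/A₀)(p₁(g_h)/p₀(g_h))ε_h + L^{−N}N^{1/2}O(1)B₃³B₅M⁶ε_h
< αε_h. (1.94) The last inequality holds under two restrictions on N"* — PROVED: the first restriction (`RestrN194 N C x ν
p₀ p₁`, `x = log g_h⁻² ≧ 1`) together with the `γ`-smallness `B₃(1+β₀)(A₁/A₀)C^{1/2}x^{−1} < ½α` bounds the first term by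
`< ½αε_h` (`term1_le`), the second restriction AS PRINTED (*"the constant in the second term above can be bounded by
(1/2)α"*: `Linv·N^{1/2}·K₂ ≦ ½α`, `Linv = L^{−N}`, `K₂ = O(1)B₃³B₅M⁶`) bounds the second by `≦ ½αε_h`; `ε_h > 0`.
[cite: Balaban1989LargeFieldI, (1.94) p.198] -/
theorem ineq194_last {B₃ β₀ A₀ A₁ x N ν C K₂ Linv α εh : ℝ} {p₀ p₁ : ℕ}
    (hR : RestrN194 N C x ν (p₀ : ℝ) (p₁ : ℝ)) (hx : 1 ≤ x) (hC : 0 ≤ C)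
    (hB : 0 ≤ B₃ * (1 + β₀) * (A₁ / A₀)) (hεh : 0 < εh)
    (hγ : B₃ * (1 + β₀) * (A₁ / A₀) * Real.sqrt C * x ^ (-1 : ℝ) < α / 2)
    (h2 : Linv * Real.sqrt N * K₂ ≤ α / 2) :
    B₃ * ((1 + β₀) * Real.sqrt N * ((A₁ / A₀) * (x ^ p₁ / x ^ p₀) * εh)) + Linv * Real.sqrt N * K₂ * εh
      < α * εh := by
  have h1 := term1_le hR hx hC hB hεh.le
  have h1' : B₃ * (1 + β₀) * (A₁ / A₀) * Real.sqrt C * x ^ (-1 : ℝ) * εh < α / 2 * εh :=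
    mul_lt_mul_of_pos_right hγ hεh
  have h2' : Linv * Real.sqrt N * K₂ * εh ≤ α / 2 * εh := mul_le_mul_of_nonneg_right h2 hεh.le
  linarith

/-! ## §3. The whole chain after the ℍ-input, along a flow -/

section AlongFlow

variable (F : Flow) (K : ℕ) {γ β' β₀ : ℝ} {L p₀ p₁ : ℕ}

/-- **(1.94) without its first member, ALONG ANY RENORMALIZATION GROUP FLOW of the [III] setting**: for `h < k ≦ K`,
`N = k − h`, `x = log g_h⁻²`: (0.20) up to `K`, `0 < g_j ≦ γ`, `β_{j+1}(g_j) ≦ β′`, `SmallnessFor γ β′ β₀ L p₀`, `p₁ ≦ p₀`,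
`0 < A₀`, `0 ≦ A₁, B₃, C₂` (`C₂ = O(1)B₃³B₅M⁶`), `0 < Lr` — the hypotheses of `B15.Ineq194Flow.ineq194_first_le_signfree`
— plus the two restrictions on `N` (`RestrN194 N C x ν p₀ p₁` with `x ≧ 1`, and `Lr^{−N}N^{1/2}C₂(1+β₀) ≦ ½α`) and the
`γ`-clause `B₃(1+β₀)(A₁/A₀)C^{1/2}x^{−1} < ½α`:
`B₃δ′_k + Lr^{−N}·C₂·ε_k < α·ε_h`. [cite: Balaban1989LargeFieldI, (1.94) p.198] -/
theorem ineq194_chain_along_flow (S : SmallnessFor γ β' β₀ L p₀) (hp : p₁ ≤ p₀) {A₀ A₁ B₃ C₂ Lr : ℝ}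
    (hA₀ : 0 < A₀) (hA₁ : 0 ≤ A₁) (hB₃ : 0 ≤ B₃) (hC₂ : 0 ≤ C₂) (hLr : 0 < Lr) (hrg : F.SatisfiesRG K)
    (hI : F.InInterval γ K) (hub : ∀ j, j < K → F.β (j + 1) (F.g j) ≤ β') {h k : ℕ} (hhk : h < k) (hkK : k ≤ K)
    {C ν α : ℝ} (hC : 0 ≤ C)
    (hR : RestrN194 ((k : ℝ) - h) C (Real.log ((F.g h) ^ 2)⁻¹) ν (p₀ : ℝ) (p₁ : ℝ))
    (hx : 1 ≤ Real.log ((F.g h) ^ 2)⁻¹)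
    (hγ : B₃ * (1 + β₀) * (A₁ / A₀) * Real.sqrt C * (Real.log ((F.g h) ^ 2)⁻¹) ^ (-1 : ℝ) < α / 2)
    (h2 : Lr ^ (-((k : ℝ) - h)) * Real.sqrt ((k : ℝ) - h) * (C₂ * (1 + β₀)) ≤ α / 2) :
    B₃ * deltaPrimeK A₁ p₁ F k + Lr ^ (-((k : ℝ) - h)) * C₂ * epsK A₀ p₀ F k < α * epsK A₀ p₀ F h := by
  have hfirst := ineq194_first_le_signfree F K S hp hA₀ hA₁ hB₃ hC₂ hLr hrg hI hub hhk hkK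
  have hgh : 0 < F.g h ∧ F.g h ≤ γ := hI h (le_trans hhk.le hkK)
  have hεh : 0 < epsK A₀ p₀ F h := by
    unfold epsK p0Profile
    have : 0 < Real.log ((F.g h) ^ 2)⁻¹ := by linarith
    have := hgh.1
    positivity
  have hB : 0 ≤ B₃ * (1 + β₀) * (A₁ / A₀) := by
    have := S.β₀_pos.le
    positivity
  have hlast := ineq194_last (Linv := Lr ^ (-((k : ℝ) - h))) (K₂ := C₂ * (1 + β₀)) hR hx hC hB hεh hγ h2
  unfold logPow at hfirst
  linarith

end AlongFlow

end Literature.MathematicalPhysics.QuantumFieldTheory.Balaban1983to89.B15Ineq194Last
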